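/-
Copyright: statement-level skeleton of a published paper (lit-balaban cell, Phase-2 proof seat p37 gen 108). No claims beyond
what the kernel checks below.
-/
import Mathlib
import Literature.MathematicalPhysics.QuantumFieldTheory.Balaban1983to89.B3GraphGlueAmplitude
import Literature.MathematicalPhysics.QuantumFieldTheory.Balaban1983to89.B3GraphAmplitudeRules

/-!
# B3 — T. Bałaban, *(Higgs)₂,₃ quantum fields in a finite volume. III. Renormalization*, CMP **88** (1983) 411–445
[Balaban1983Higgs3], pp. 413–416, 419–420 [PDF 3–6, 9–10]: **THE CUTTING RULE ON THE CONCRETE EXPRESSION E(G, {□(v)}, Φ_ext, A_ext)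
of p26's `B3GraphAmplitudeRules.graphAmp`** — the Feynman rules of a glued graph ARE the catalogue's rules (1.6)–(1.15) of its
vertices with the juxtaposed counterterm labels and localizations (`glueRules_rulesOf`), the external legs of the glued graph are
those of the pieces (`extSEquiv/extVEquiv/extOEquiv`), product external fields split (`extS_glue/prodExtV_glue/extO_glue`), and
**E(glue G₁ G₂ a b, {□(v)}, Πφ_ℓ, ΠA_ℓ) = Σ_{p,q} K_new(p,q) · E(G₁, {□(v)}, φ′-leg a ↦ δ_p) · E(G₂, {□(v)}, φ′-leg b ↦ δ_q)**
(`graphAmp_glue`, `graphAmp_glue_prod`; FILE K4 of the cutting rule; K1 = `B3PairingLineCalculus`, K2 = `B3GraphGlueAmplitude`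
(`amp_glue` on the index-form evaluator), K3 = `B3OnePIChainAmplitude` (chains of insertions = matrix products of (1.21)))

statement-level skeleton of published theorems with citation tags; proofs where landed; nothing here is a claim about
the Yang–Mills mass gap

PDF held: `paper:balaban1983-higgs-2-3-quantum-fields-finite-volume` (journal page = PDF page + 410); pp. 414–416, 420 read on the ×2
renders `run/shared/lean/pub/pub-balaban/b2b-balaban-ref1/pages/1983-cmp88-higgs23-III/…-p004,p005,p006,p010-x2.png`.

CITATION HEADER (lean-in-tree rule).  lit-balaban TYPED SKELETON (HOME `run/shared/lean/pub/lit-balaban/`), PHASE 2, seat p37 gen 108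
(unit `lit-balaban-p37`; TAKING (K), HOME/STATUS.md 2026-08-23T12:42:19Z, free-target protocol G.5-34(d)); row **B3.Eq1.19-1.22** of
`HOME/lit-balaban-r15/ROWS-B3.md` ((1.21) p. 416; fold owner r15; head `proved` under the lead's HEAD WORD Q25 2026-08-23T08:24:18Z,
reading (P) — this file is an OPTIONAL located member of its (1.21) cell, zero head weight; the owner's Q28 text 2026-08-23T12:30:56Z
lists *"amputation as an operation on the concrete expansion"* as not in the tree — FILE K2 proved the cutting rule on the index-form
evaluator `amp` with the vertex rules as parameters; this file specializes it to p26's CONCRETE expression `graphAmp` (the rules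
(1.6)–(1.15) of the (Higgs)₂,₃ model with localizations, p. 420) and to PRODUCT external fields, where "leg a ↦ δ_p" is literally
the external field of leg `a` replaced by the basis field `basisE p = δ_x ⊗ e_a`).
CONSUMES BY NAME, nothing re-declared: p18's `B3Cor23Concrete.Graph`/`Leg`; p37's `B3GraphGlue.glue` (p362777); p26's FILE 1
`B3GraphAmplitude` (`SLeg/VLeg/OLeg`, `sPairing/vPairing`, `ExtSLeg/ExtVLeg`, `OutPairing(.Ext)`, `Rules`, `prodExtV`, `amp`; p361338)
and FILE 2 `B3GraphAmplitudeRules` (`Model`, `Loc`, `ruleOfKind`, `rulesOf`, `basisE`/`basisE_apply`, `extS`, `extO`, **`graphAmp`**;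
p363368 lineage); FILE K1 `B3PairingLineCalculus` (`glueP_other_inl/inr_eq_none_iff`, `sumP_other_inl/inr`, `transportP_other_apply`;
p365622) and FILE K2 `B3GraphGlueAmplitude` (`flegL/flegR` + injectivity, `eS/eV/eO`, `sleg`, `spartner_sleg`, `jointS`, `spartner_glue`,
`vpartner_glue`, `gluePo`, `glueRules(_castAdd/_natAdd)`, `glueKs/glueKv/glueKo`, `extL/extR/extVL/extVR/extOL/extOR`, **`amp_glue`**;
p366933).

THE PRINTED TEXT (verbatim), p. 414 [PDF 4], lines 36–41 of the page (v1.1: the v1.0 header starred a gloss at this place — referee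
ref-4 D-g74-2; the sentence below is the printed one, re-read on the OCR text layer p0004): *"Now we can describe an arbitrary expression
in the expansion. It consists of a number of vertices. … All the A′-legs are contracted, i.e. they are divided into pairs and each pair
is replaced by the corresponding propagator. Some φ′-legs are replaced by external scalar fields and the remaining are again divided into
pairs and each pair is replaced by a propagator."*  (Gloss, ours, not print: the legs of the vertices are split into the paired ones —
each pair becoming a propagator, i.e. an internal line — and the unpaired ones, which carry the external fields; cutting one internal
line therefore returns its two legs to the unpaired set, which is what the cutting rule below does on the evaluator.)  p. 416 [PDF 6], (1.21):
*"G^ε = Σ_{n=0}^{∞} C^ε_0[(−δm² + Σ^ε + …)C^ε_0]ⁿ … Σ^ε, Σ^ε_1, Σ^ε_2 are given by amputated, one-particle-irreducible graphs"*.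
p. 420 [PDF 10]: *"with each expression there is connected some localization {□(v)}_{v∈G} … E(G, {□(v)}_{v∈G}, Φ_ext, A_ext)"*.

WHAT IS TYPED / PROVED (definitions with bodies + theorems; no `Prop` fact, no `sorry`; standard axioms).
§1 THE EXTERNAL LEGS OF THE GLUED GRAPH ARE THOSE OF THE PIECES: `extL_extR_bijective`, **`extSEquiv`**:
`{x : ExtSLeg G₁ // x ≠ a} ⊕ {y : ExtSLeg G₂ // y ≠ b} ≃ ExtSLeg (glue G₁ G₂ a b)` (FILE K2 had the two embeddings `extL/extR`;
here: jointly bijective — every external φ′-leg of the glued graph is an old one other than the two cut legs), **`extVEquiv`**: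
`ExtVLeg G₁ ⊕ ExtVLeg G₂ ≃ ExtVLeg (glue …)`, **`extOEquiv`**: `Po₁.Ext ⊕ Po₂.Ext ≃ (gluePo Po₁ Po₂).Ext` (+ `_inl/_inr` simp lemmas);
`prod_extSLeg_glue/prod_extVLeg_glue/prod_extO_glue` (products over the external legs split).
§2 PRODUCT EXTERNAL DATA SPLIT ACROSS THE CUT: **`extS_glue`** (p26's product φ-fields `extS`), **`prodExtV_glue`** (p26's product
A′_ext-fields `prodExtV`), **`extO_glue`** (p26's (1.12)×(1.18) output field `extO`) — so the product-form hypotheses `hΦ/hA/hΨ` of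
FILE K2's `amp_glue` hold for p26's concrete external data.
§3 THE RULES OF THE GLUED GRAPH: `ruleOfKind_cast` (re-indexing the slots of a rule along an equality of kinds), **`glueRules_rulesOf`**:
`glueRules (rulesOf G₁ M dm2₁ loc₁) (rulesOf G₂ M dm2₂ loc₂) = rulesOf (glue G₁ G₂ a b) M (Fin.append dm2₁ dm2₂) (Fin.append loc₁ loc₂)`
— gluing does not touch the vertices: each keeps its kind, hence its rule (1.6)–(1.15), its counterterm label and its localization.
§4 THE CUTTING RULE ON `graphAmp`: **`graphAmp_glue`** (general product-form external data, hypotheses as in K2),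
`indicator_mul_prod_eq_extS` (the indicator-restricted product field of a piece IS p26's `extS` with the cut leg's field replaced by
the basis field `basisE p`), and **`graphAmp_glue_prod`**:
E(glue G₁ G₂ a b, M, dm2₁⧺dm2₂, loc₁⧺loc₂, extS φ, prodExtV A, extO κ ψ)
  = Σ_{p q} Knew p q · E(G₁, M, dm2₁, loc₁, extS φ₁[a ↦ basisE p], prodExtV A₁, extO κ ψ) · E(G₂, M, dm2₂, loc₂, extS φ₂[b ↦ basisE q], prodExtV A₂, extO κ ψ)
for external fields `φ`, `A` of the glued graph that restrict to the pieces' `φ₁/φ₂`, `A₁/A₂` on the old legs.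
HONEST SCOPE.  (a) Exactly FILE K2's cutting rule, specialized: nothing about the rules (1.6)–(1.15) is used beyond "vertex `i` of the
glued graph has the kind, label and localization of the vertex it came from"; (b) the new line's kernel `Knew` is a parameter (in
(1.21): the entries of `C^ε_0`; in (2.7): a piece of the scale decomposition) — supplied, as all line kernels of p26's evaluator;
(c) FILE K2 (b)–(d) apply verbatim (output pairing juxtaposed; product form across the cut; index form only, no convergence, no
estimate).  Definitions with bodies + theorems; no `Prop` fact, no `sorry`; standard axioms.  Unit `lit-balaban-p37` gen 108
(literature-prover-lit-balaban-p37-g108-0), HOME `run/shared/lean/pub/lit-balaban/`, 2026-08-23.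
-/

open Finset
open scoped BigOperators

namespace Literature.MathematicalPhysics.QuantumFieldTheory.Balaban1983to89.B3GraphGlueAmplitudeRules

open B3Prop1 B3Cor23Concrete B3GraphGlueLegs B3GraphGlue B3GraphAmplitude B3PairingLineCalculus B3GraphGlueAmplitude
  B3GraphAmplitudeRules

noncomputable section

/-! ## §1 The external legs of the glued graph are those of the pieces -/

section ExtLegs

variable {nbar : ℕ} {G₁ G₂ : Graph nbar} {a : Leg G₁.kind} {b : Leg G₂.kind} {ha : G₁.other a = none}
  {hb : G₂.other b = none} {hab : a.2.isLeft = b.2.isLeft} (hsa : a.2.isLeft = true) (hsb : b.2.isLeft = true)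

/-- The glued graph of this file's statements: p37's `glue G₁ G₂ a b` (abbreviation for readability). [cite: Balaban1983Higgs3, (1.21) p.416] -/
local notation "GG" => glue G₁ G₂ a b ha hb hab

/-- **Every external φ′-leg of the glued graph is an external φ′-leg of exactly one piece, other than the cut legs `a`, `b`**:
FILE K2's embeddings `extL`, `extR` are jointly bijective. [cite: Balaban1983Higgs3, (1.21) p.416] [cite: Balaban1983Higgs3, p.414] -/
theorem extL_extR_bijective :
    Function.Bijective (Sum.elim (extL (ha := ha) (hb := hb) (hab := hab) hsa hsb) (extR (ha := ha) (hb := hb) (hab := hab) hsa hsb)) := by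
  refine ⟨?_, ?_⟩
  · rintro (x | y) (x' | y') h
    · exact congrArg Sum.inl (Subtype.ext (Subtype.ext (flegL_injective _ _ _ (congrArg Subtype.val h))))
    · exact absurd (congrArg Subtype.val h) (flegL_ne_flegR _ _ _ _ _)
    · exact absurd (congrArg Subtype.val h).symm (flegL_ne_flegR _ _ _ _ _)
    · exact congrArg Sum.inr (Subtype.ext (Subtype.ext (flegR_injective _ _ _ (congrArg Subtype.val h))))
  · rintro ⟨ℓ, hℓ⟩
    obtain ⟨w, rfl⟩ := (eS (G₁ := G₁) (G₂ := G₂)).surjective ℓ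
    have h := spartner_glue (ha := ha) (hb := hb) (hab := hab) hsa hsb w
    rw [hℓ] at h
    have hw : (jointS (ha := ha) (hb := hb) hsa hsb).other w = none := by simpa using h.symm
    rcases w with x | y
    · obtain ⟨hx, hx'⟩ := (glueP_other_inl_eq_none_iff _ _ _ _ x).1 hw
      exact ⟨Sum.inl ⟨⟨x, hx'⟩, hx⟩, rfl⟩
    · obtain ⟨hy, hy'⟩ := (glueP_other_inr_eq_none_iff _ _ _ _ y).1 hw
      exact ⟨Sum.inr ⟨⟨y, hy'⟩, hy⟩, rfl⟩

/-- **The external φ′-legs of the glued graph are those of `G₁` other than `a` and those of `G₂` other than `b`** (p. 414: the cut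
legs `a`, `b` are now paired — replaced by the propagator — all other unpaired legs stay unpaired). [cite: Balaban1983Higgs3, (1.21) p.416]
[cite: Balaban1983Higgs3, p.414] -/
def extSEquiv : {x : ExtSLeg G₁ // x.1 ≠ sleg a hsa} ⊕ {y : ExtSLeg G₂ // y.1 ≠ sleg b hsb} ≃ ExtSLeg GG :=
  Equiv.ofBijective _ (extL_extR_bijective (ha := ha) (hb := hb) (hab := hab) hsa hsb)

/-- kernel. [cite: Balaban1983Higgs3, (1.21) p.416] -/
@[simp] theorem extSEquiv_inl (x : {x : ExtSLeg G₁ // x.1 ≠ sleg a hsa}) :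
    extSEquiv (ha := ha) (hb := hb) (hab := hab) hsa hsb (Sum.inl x) = extL (ha := ha) (hb := hb) (hab := hab) hsa hsb x := rfl

/-- kernel. [cite: Balaban1983Higgs3, (1.21) p.416] -/
@[simp] theorem extSEquiv_inr (y : {y : ExtSLeg G₂ // y.1 ≠ sleg b hsb}) :
    extSEquiv (ha := ha) (hb := hb) (hab := hab) hsa hsb (Sum.inr y) = extR (ha := ha) (hb := hb) (hab := hab) hsa hsb y := rfl

/-- **Every external A′-leg of the glued graph is an external A′-leg of exactly one piece**: FILE K2's `extVL`, `extVR` are jointly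
bijective. [cite: Balaban1983Higgs3, (1.21) p.416] [cite: Balaban1983Higgs3, p.414] -/
theorem extVL_extVR_bijective :
    Function.Bijective (Sum.elim (extVL (ha := ha) (hb := hb) (hab := hab) hsa hsb) (extVR (ha := ha) (hb := hb) (hab := hab) hsa hsb)) := by
  refine ⟨?_, ?_⟩
  · rintro (x | y) (x' | y') h
    · exact congrArg Sum.inl (Subtype.ext (flegL_injective _ _ _ (congrArg Subtype.val h)))
    · exact absurd (congrArg Subtype.val h) (flegL_ne_flegR _ _ _ _ _)
    · exact absurd (congrArg Subtype.val h).symm (flegL_ne_flegR _ _ _ _ _)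
    · exact congrArg Sum.inr (Subtype.ext (flegR_injective _ _ _ (congrArg Subtype.val h)))
  · rintro ⟨ℓ, hℓ⟩
    obtain ⟨w, rfl⟩ := (eV (G₁ := G₁) (G₂ := G₂)).surjective ℓ
    have h := vpartner_glue (ha := ha) (hb := hb) (hab := hab) hsa hsb w
    rw [hℓ] at h
    rcases w with x | y
    · have hx : (vPairing G₁).other x = none := by simpa using h.symm
      exact ⟨Sum.inl ⟨x, hx⟩, rfl⟩
    · have hy : (vPairing G₂).other y = none := by simpa using h.symm
      exact ⟨Sum.inr ⟨y, hy⟩, rfl⟩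

/-- **The external A′-legs of the glued graph are those of the two pieces** (the new line is scalar). [cite: Balaban1983Higgs3, (1.21) p.416]
[cite: Balaban1983Higgs3, p.414] -/
def extVEquiv : ExtVLeg G₁ ⊕ ExtVLeg G₂ ≃ ExtVLeg GG :=
  Equiv.ofBijective _ (extVL_extVR_bijective (ha := ha) (hb := hb) (hab := hab) hsa hsb)

/-- kernel. [cite: Balaban1983Higgs3, (1.21) p.416] -/
@[simp] theorem extVEquiv_inl (x : ExtVLeg G₁) :
    extVEquiv (ha := ha) (hb := hb) (hab := hab) hsa hsb (Sum.inl x) = extVL (ha := ha) (hb := hb) (hab := hab) hsa hsb x := rfl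

/-- kernel. [cite: Balaban1983Higgs3, (1.21) p.416] -/
@[simp] theorem extVEquiv_inr (y : ExtVLeg G₂) :
    extVEquiv (ha := ha) (hb := hb) (hab := hab) hsa hsb (Sum.inr y) = extVR (ha := ha) (hb := hb) (hab := hab) hsa hsb y := rfl

/-- **Every unpaired output of the glued graph is an unpaired output of exactly one piece** (the (1.18) pairing of the glued graph
is the juxtaposition `gluePo` of the pieces' pairings): FILE K2's `extOL`, `extOR` are jointly bijective. [cite: Balaban1983Higgs3, (1.18) p.415] -/
theorem extOL_extOR_bijective (Po₁ : OutPairing G₁) (Po₂ : OutPairing G₂) :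
    Function.Bijective (Sum.elim (extOL (ha := ha) (hb := hb) (hab := hab) Po₁ Po₂) (extOR (ha := ha) (hb := hb) (hab := hab) Po₁ Po₂)) := by
  refine ⟨?_, ?_⟩
  · rintro (x | y) (x' | y') h
    · exact congrArg Sum.inl (Subtype.ext (flegL_injective _ _ _ (congrArg Subtype.val h)))
    · exact absurd (congrArg Subtype.val h) (flegL_ne_flegR _ _ _ _ _)
    · exact absurd (congrArg Subtype.val h).symm (flegL_ne_flegR _ _ _ _ _)
    · exact congrArg Sum.inr (Subtype.ext (flegR_injective _ _ _ (congrArg Subtype.val h)))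
  · rintro ⟨ℓ, hℓ⟩
    obtain ⟨w, rfl⟩ := (eO (G₁ := G₁) (G₂ := G₂)).surjective ℓ
    have h := transportP_other_apply (Po₁.sumP Po₂) (eO (G₁ := G₁) (G₂ := G₂)) w
    change ((Po₁.sumP Po₂).transportP eO).other (eO w) = none at hℓ
    rw [hℓ] at h
    rcases w with x | y
    · have hx : Po₁.other x = none := by simpa using h.symm
      exact ⟨Sum.inl ⟨x, hx⟩, rfl⟩
    · have hy : Po₂.other y = none := by simpa using h.symm
      exact ⟨Sum.inr ⟨y, hy⟩, rfl⟩

/-- **The unpaired outputs of the glued graph are those of the two pieces.** [cite: Balaban1983Higgs3, (1.18) p.415] -/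
def extOEquiv (Po₁ : OutPairing G₁) (Po₂ : OutPairing G₂) :
    Po₁.Ext ⊕ Po₂.Ext ≃ (gluePo (ha := ha) (hb := hb) (hab := hab) Po₁ Po₂).Ext :=
  Equiv.ofBijective _ (extOL_extOR_bijective (ha := ha) (hb := hb) (hab := hab) Po₁ Po₂)

/-- kernel. [cite: Balaban1983Higgs3, (1.18) p.415] -/
@[simp] theorem extOEquiv_inl (Po₁ : OutPairing G₁) (Po₂ : OutPairing G₂) (x : Po₁.Ext) :
    extOEquiv (ha := ha) (hb := hb) (hab := hab) Po₁ Po₂ (Sum.inl x) = extOL (ha := ha) (hb := hb) (hab := hab) Po₁ Po₂ x := rfl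

/-- kernel. [cite: Balaban1983Higgs3, (1.18) p.415] -/
@[simp] theorem extOEquiv_inr (Po₁ : OutPairing G₁) (Po₂ : OutPairing G₂) (y : Po₂.Ext) :
    extOEquiv (ha := ha) (hb := hb) (hab := hab) Po₁ Po₂ (Sum.inr y) = extOR (ha := ha) (hb := hb) (hab := hab) Po₁ Po₂ y := rfl

/-- **A product over the external φ′-legs of the glued graph is the product over those of `G₁` other than `a` times the product
over those of `G₂` other than `b`.** [cite: Balaban1983Higgs3, (1.21) p.416] -/
theorem prod_extSLeg_glue (f : ExtSLeg GG → ℝ) :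
    ∏ ℓ, f ℓ = (∏ x : {x : ExtSLeg G₁ // x.1 ≠ sleg a hsa}, f (extL (ha := ha) (hb := hb) (hab := hab) hsa hsb x)) *
      ∏ y : {y : ExtSLeg G₂ // y.1 ≠ sleg b hsb}, f (extR (ha := ha) (hb := hb) (hab := hab) hsa hsb y) := by
  rw [← Fintype.prod_equiv (extSEquiv (ha := ha) (hb := hb) (hab := hab) hsa hsb) (fun w => f (extSEquiv hsa hsb w)) f
    fun _ => rfl, Fintype.prod_sum_type]
  rfl

/-- **A product over the external A′-legs of the glued graph is the product over those of `G₁` times the product over those of `G₂`.**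
[cite: Balaban1983Higgs3, (1.21) p.416] -/
theorem prod_extVLeg_glue (f : ExtVLeg GG → ℝ) :
    ∏ ℓ, f ℓ = (∏ x : ExtVLeg G₁, f (extVL (ha := ha) (hb := hb) (hab := hab) hsa hsb x)) *
      ∏ y : ExtVLeg G₂, f (extVR (ha := ha) (hb := hb) (hab := hab) hsa hsb y) := by
  rw [← Fintype.prod_equiv (extVEquiv (ha := ha) (hb := hb) (hab := hab) hsa hsb) (fun w => f (extVEquiv hsa hsb w)) f
    fun _ => rfl, Fintype.prod_sum_type]
  rfl

/-- **A product over the unpaired outputs of the glued graph is the product over those of `G₁` times the product over those of `G₂`.**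
[cite: Balaban1983Higgs3, (1.18) p.415] -/
theorem prod_extO_glue (Po₁ : OutPairing G₁) (Po₂ : OutPairing G₂) (f : (gluePo (ha := ha) (hb := hb) (hab := hab) Po₁ Po₂).Ext → ℝ) :
    ∏ ℓ, f ℓ = (∏ x : Po₁.Ext, f (extOL (ha := ha) (hb := hb) (hab := hab) Po₁ Po₂ x)) *
      ∏ y : Po₂.Ext, f (extOR (ha := ha) (hb := hb) (hab := hab) Po₁ Po₂ y) := by
  rw [← Fintype.prod_equiv (extOEquiv (ha := ha) (hb := hb) (hab := hab) Po₁ Po₂) (fun w => f (extOEquiv Po₁ Po₂ w)) f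
    fun _ => rfl, Fintype.prod_sum_type]
  rfl

end ExtLegs

/-! ## §2 Product external data split across the cut -/

section ProductData

variable {P : HiggsLattice.Params} {N k : ℕ}
variable {nbar : ℕ} {G₁ G₂ : Graph nbar} {a : Leg G₁.kind} {b : Leg G₂.kind} {ha : G₁.other a = none}
  {hb : G₂.other b = none} {hab : a.2.isLeft = b.2.isLeft} (hsa : a.2.isLeft = true) (hsb : b.2.isLeft = true)

local notation "GG" => glue G₁ G₂ a b ha hb hab

/-- **p26's product external φ-fields `extS` (one `W`-valued field per external φ′-leg, p. 419) of the glued graph split into the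
product over the legs of `G₁` other than `a` and the product over the legs of `G₂` other than `b`.** [cite: Balaban1983Higgs3, p.419]
[cite: Balaban1983Higgs3, (1.21) p.416] -/
theorem extS_glue (φ : ExtSLeg GG → HiggsLattice.ScalarField P 0 N) (γ : ExtSLeg GG → HiggsLattice.Site P 0 × Fin N) :
    extS GG φ γ =
      (∏ x : {x : ExtSLeg G₁ // x.1 ≠ sleg a hsa}, φ (extL (ha := ha) (hb := hb) (hab := hab) hsa hsb x)
          (γ (extL (ha := ha) (hb := hb) (hab := hab) hsa hsb x)).1 (γ (extL (ha := ha) (hb := hb) (hab := hab) hsa hsb x)).2) *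
        ∏ y : {y : ExtSLeg G₂ // y.1 ≠ sleg b hsb}, φ (extR (ha := ha) (hb := hb) (hab := hab) hsa hsb y)
          (γ (extR (ha := ha) (hb := hb) (hab := hab) hsa hsb y)).1 (γ (extR (ha := ha) (hb := hb) (hab := hab) hsa hsb y)).2 :=
  prod_extSLeg_glue (ha := ha) (hb := hb) (hab := hab) hsa hsb _

/-- **p26's product external A′-fields `prodExtV` of the glued graph split into the pieces' products.** [cite: Balaban1983Higgs3, p.419]
[cite: Balaban1983Higgs3, (1.21) p.416] -/
theorem prodExtV_glue {Bd : Type*} (A : ExtVLeg GG → Bd → ℝ) (ζ : ExtVLeg GG → Bd) :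
    prodExtV A ζ =
      prodExtV (fun x => A (extVL (ha := ha) (hb := hb) (hab := hab) hsa hsb x))
          (fun x => ζ (extVL (ha := ha) (hb := hb) (hab := hab) hsa hsb x)) *
        prodExtV (fun y => A (extVR (ha := ha) (hb := hb) (hab := hab) hsa hsb y))
          (fun y => ζ (extVR (ha := ha) (hb := hb) (hab := hab) hsa hsb y)) :=
  prod_extVLeg_glue (ha := ha) (hb := hb) (hab := hab) hsa hsb _

/-- **p26's (1.12)×(1.18) output field `extO` of the glued graph (the unpaired averaging outputs against the external field `ψ`,
coefficient `−κ`) splits into the pieces' output fields.** [cite: Balaban1983Higgs3, (1.18) p.415] -/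
theorem extO_glue (Po₁ : OutPairing G₁) (Po₂ : OutPairing G₂) (κ : ℝ) (ψ : HiggsLattice.ScalarField P k N)
    (ξ : (gluePo (ha := ha) (hb := hb) (hab := hab) Po₁ Po₂).Ext → HiggsLattice.Site P k × Fin N) :
    extO GG (gluePo Po₁ Po₂) κ ψ ξ =
      extO G₁ Po₁ κ ψ (fun x => ξ (extOL (ha := ha) (hb := hb) (hab := hab) Po₁ Po₂ x)) *
        extO G₂ Po₂ κ ψ (fun y => ξ (extOR (ha := ha) (hb := hb) (hab := hab) Po₁ Po₂ y)) :=
  prod_extO_glue (ha := ha) (hb := hb) (hab := hab) Po₁ Po₂ _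

/-- **The external function of a cut piece**: the product field of the legs other than the cut leg `a`, restricted by the indicator
`[γ a = p]` to the assignments giving the cut leg the index `p` (FILE K2's form), IS p26's product field `extS` with the field of leg
`a` REPLACED BY THE BASIS FIELD `basisE p = δ_x ⊗ e_a` — "E(G₁)[a ↦ δ_p]". [cite: Balaban1983Higgs3, p.414] [cite: Balaban1983Higgs3, (1.21) p.416] -/
theorem indicator_mul_prod_eq_extS {G : Graph nbar} (c : ExtSLeg G) (φ₁ : ExtSLeg G → HiggsLattice.ScalarField P 0 N)
    (p : HiggsLattice.Site P 0 × Fin N) (γ : ExtSLeg G → HiggsLattice.Site P 0 × Fin N) :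
    (if γ c = p then 1 else 0) * ∏ x : {x : ExtSLeg G // x.1 ≠ c.1}, φ₁ x.1 (γ x.1).1 (γ x.1).2 =
      extS G (Function.update φ₁ c (basisE p)) γ := by
  unfold extS
  rw [Fintype.prod_eq_mul_prod_compl c]
  congr 1
  · rw [Function.update_self, basisE_apply]
    by_cases h : γ c = p
    · rw [if_pos h, if_pos ⟨congrArg Prod.fst h, congrArg Prod.snd h⟩]
    · rw [if_neg h, if_neg fun hh => h (Prod.ext hh.1 hh.2)]
  · rw [Finset.prod_subtype (p := fun x : ExtSLeg G => x.1 ≠ c.1) ({c}ᶜ) fun x => by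
      rw [Finset.mem_compl, Finset.mem_singleton, ne_eq, Subtype.ext_iff]]
    exact Fintype.prod_congr _ _ fun x => by rw [Function.update_of_ne fun h => x.2 (congrArg Subtype.val h)]

end ProductData

/-! ## §3 The Feynman rules of the glued graph are the catalogue's rules of its vertices -/

section Rules

variable {P : HiggsLattice.Params} {N k : ℕ}

/-- kernel: the rule of a kind, read through an equality of kinds, is the same rule with re-indexed slots.
[cite: Balaban1983Higgs3, (1.6)–(1.15) pp.413–414] -/
theorem ruleOfKind_cast (M : Model P N k) (dm2 : HiggsLattice.Site P 0 → ℝ) (l : Loc P k) {κ κ' : VertexKind} (h : κ = κ')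
    (fs : Fin κ.scalarLegs → HiggsLattice.ScalarField P 0 N) (fv : Fin κ.vectorLegs → HiggsLattice.VecField P 0)
    (fo : Fin (outSlots κ) → HiggsLattice.ScalarField P k N) :
    ruleOfKind k M dm2 l κ fs fv fo =
      ruleOfKind k M dm2 l κ' (fun j => fs (Fin.cast (congrArg VertexKind.scalarLegs h.symm) j))
        (fun j => fv (Fin.cast (congrArg VertexKind.vectorLegs h.symm) j))
        (fun j => fo (Fin.cast (congrArg outSlots h.symm) j)) := by
  subst h
  rfl

variable {nbar : ℕ} {G₁ G₂ : Graph nbar} {a : Leg G₁.kind} {b : Leg G₂.kind} {ha : G₁.other a = none}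
  {hb : G₂.other b = none} {hab : a.2.isLeft = b.2.isLeft}

local notation "GG" => glue G₁ G₂ a b ha hb hab

/-- **THE FEYNMAN RULES OF THE GLUED GRAPH ARE THE CATALOGUE'S RULES OF ITS VERTICES**: gluing FILE 2's rules `rulesOf` of the two
pieces (FILE K2's `glueRules`) gives `rulesOf` of the glued graph with the juxtaposed counterterm labels `δm_i²` and localizations
`{□(v)}` — a vertex keeps its kind (1.6)–(1.15), its label and its localization under gluing. [cite: Balaban1983Higgs3, (1.6)–(1.15) pp.413–414]
[cite: Balaban1983Higgs3, p.420] -/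
theorem glueRules_rulesOf (M : Model P N k) (dm2₁ : Fin G₁.nV → HiggsLattice.Site P 0 → ℝ)
    (dm2₂ : Fin G₂.nV → HiggsLattice.Site P 0 → ℝ) (loc₁ : Fin G₁.nV → Loc P k) (loc₂ : Fin G₂.nV → Loc P k) :
    glueRules (ha := ha) (hb := hb) (hab := hab) (rulesOf G₁ M dm2₁ loc₁) (rulesOf G₂ M dm2₂ loc₂) =
      rulesOf GG M (Fin.append dm2₁ dm2₂) (Fin.append loc₁ loc₂) := by
  funext v fs fv fo
  induction v using Fin.addCases with
  | left i =>
    rw [glueRules_castAdd]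
    unfold rulesOf
    rw [Fin.append_left dm2₁ dm2₂ i, Fin.append_left loc₁ loc₂ i]
    exact (ruleOfKind_cast M (dm2₁ i) (loc₁ i) (Fin.append_left G₁.kind G₂.kind i) fs fv fo).symm
  | right j =>
    rw [glueRules_natAdd]
    unfold rulesOf
    rw [Fin.append_right dm2₁ dm2₂ j, Fin.append_right loc₁ loc₂ j]
    exact (ruleOfKind_cast M (dm2₂ j) (loc₂ j) (Fin.append_right G₁.kind G₂.kind j) fs fv fo).symm

end Rules

/-! ## §4 The cutting rule on E(G, {□(v)}, Φ_ext, A_ext) -/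

section Cutting

variable {P : HiggsLattice.Params} {N k : ℕ}
variable {nbar : ℕ} {G₁ G₂ : Graph nbar} {a : Leg G₁.kind} {b : Leg G₂.kind} {ha : G₁.other a = none}
  {hb : G₂.other b = none} {hab : a.2.isLeft = b.2.isLeft} (hsa : a.2.isLeft = true) (hsb : b.2.isLeft = true)

local notation "GG" => glue G₁ G₂ a b ha hb hab

variable [DecidableEq (HiggsLattice.PBond P 0)]

/-- **THE CUTTING RULE ON THE CONCRETE EXPRESSION** (FILE K2's `amp_glue` for p26's `graphAmp` = E(G, {□(v)}, Φ_ext, A_ext) with the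
(Higgs)₂,₃ rules (1.6)–(1.15) and localizations): for the glued graph with the juxtaposed counterterm labels and localizations, the old
line kernels, the kernel `Knew` of the new line a—b (in (1.21): the entries of `C^ε_0`) and external data of product form across the cut,
E(glue G₁ G₂ a b, {□(v)}) = Σ_{p,q} Knew(p,q) · E(G₁, {□(v)})[a ↦ δ_p] · E(G₂, {□(v)})[b ↦ δ_q] — *"each pair is replaced by the
corresponding propagator"* (p. 414), read for the one pair a—b. [cite: Balaban1983Higgs3, (1.21) p.416] [cite: Balaban1983Higgs3, p.414]
[cite: Balaban1983Higgs3, p.420] -/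
theorem graphAmp_glue (M : Model P N k) (dm2₁ : Fin G₁.nV → HiggsLattice.Site P 0 → ℝ)
    (dm2₂ : Fin G₂.nV → HiggsLattice.Site P 0 → ℝ) (loc₁ : Fin G₁.nV → Loc P k) (loc₂ : Fin G₂.nV → Loc P k)
    (Po₁ : OutPairing G₁) (Po₂ : OutPairing G₂)
    (Ks₁ : SLine G₁ → HiggsLattice.Site P 0 × Fin N → HiggsLattice.Site P 0 × Fin N → ℝ)
    (Ks₂ : SLine G₂ → HiggsLattice.Site P 0 × Fin N → HiggsLattice.Site P 0 × Fin N → ℝ)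
    (Knew : HiggsLattice.Site P 0 × Fin N → HiggsLattice.Site P 0 × Fin N → ℝ)
    (Kv₁ : VLine G₁ → HiggsLattice.PBond P 0 → HiggsLattice.PBond P 0 → ℝ)
    (Kv₂ : VLine G₂ → HiggsLattice.PBond P 0 → HiggsLattice.PBond P 0 → ℝ)
    (Ko₁ : Po₁.Line oRank → HiggsLattice.Site P k × Fin N → HiggsLattice.Site P k × Fin N → ℝ)
    (Ko₂ : Po₂.Line oRank → HiggsLattice.Site P k × Fin N → HiggsLattice.Site P k × Fin N → ℝ)
    (Φ : (ExtSLeg GG → HiggsLattice.Site P 0 × Fin N) → ℝ) (A : (ExtVLeg GG → HiggsLattice.PBond P 0) → ℝ)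
    (Ψ : ((gluePo (ha := ha) (hb := hb) (hab := hab) Po₁ Po₂).Ext → HiggsLattice.Site P k × Fin N) → ℝ)
    (F₁ : ({x : ExtSLeg G₁ // x.1 ≠ sleg a hsa} → HiggsLattice.Site P 0 × Fin N) → ℝ)
    (F₂ : ({y : ExtSLeg G₂ // y.1 ≠ sleg b hsb} → HiggsLattice.Site P 0 × Fin N) → ℝ)
    (A₁ : (ExtVLeg G₁ → HiggsLattice.PBond P 0) → ℝ) (A₂ : (ExtVLeg G₂ → HiggsLattice.PBond P 0) → ℝ)
    (Ψ₁ : (Po₁.Ext → HiggsLattice.Site P k × Fin N) → ℝ) (Ψ₂ : (Po₂.Ext → HiggsLattice.Site P k × Fin N) → ℝ)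
    (hΦ : ∀ γ, Φ γ = F₁ (fun x => γ (extL (ha := ha) (hb := hb) (hab := hab) hsa hsb x)) *
      F₂ (fun y => γ (extR (ha := ha) (hb := hb) (hab := hab) hsa hsb y)))
    (hA : ∀ ζ, A ζ = A₁ (fun x => ζ (extVL (ha := ha) (hb := hb) (hab := hab) hsa hsb x)) *
      A₂ (fun y => ζ (extVR (ha := ha) (hb := hb) (hab := hab) hsa hsb y)))
    (hΨ : ∀ ξ, Ψ ξ = Ψ₁ (fun x => ξ (extOL (ha := ha) (hb := hb) (hab := hab) Po₁ Po₂ x)) *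
      Ψ₂ (fun y => ξ (extOR (ha := ha) (hb := hb) (hab := hab) Po₁ Po₂ y))) :
    graphAmp GG M (Fin.append dm2₁ dm2₂) (Fin.append loc₁ loc₂) (gluePo Po₁ Po₂) (glueKs Ks₁ Ks₂ Knew) (glueKv Kv₁ Kv₂)
        (glueKo Po₁ Po₂ Ko₁ Ko₂) Φ A Ψ =
      ∑ p : HiggsLattice.Site P 0 × Fin N, ∑ q : HiggsLattice.Site P 0 × Fin N, Knew p q *
        (graphAmp G₁ M dm2₁ loc₁ Po₁ Ks₁ Kv₁ Ko₁
            (fun γ₁ => (if γ₁ ⟨sleg a hsa, spartner_sleg ha hsa⟩ = p then 1 else 0) * F₁ (fun x => γ₁ x.1)) A₁ Ψ₁ *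
          graphAmp G₂ M dm2₂ loc₂ Po₂ Ks₂ Kv₂ Ko₂
            (fun γ₂ => (if γ₂ ⟨sleg b hsb, spartner_sleg hb hsb⟩ = q then 1 else 0) * F₂ (fun y => γ₂ y.1)) A₂ Ψ₂) := by
  unfold graphAmp
  rw [← glueRules_rulesOf]
  exact amp_glue hsa hsb _ _ _ _ _ _ _ _ _ _ _ _ _ _ _ _ _ F₁ F₂ A₁ A₂ Ψ₁ Ψ₂ hΦ hA hΨ

/-- **THE CUTTING RULE FOR PRODUCT EXTERNAL FIELDS** (p26's `extS`, `prodExtV`, `extO`): for external φ-fields `φ` and A′-fields `A`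
of the glued graph restricting on the old legs to the pieces' `φ₁/φ₂`, `A₁/A₂` (`hφ₁ hφ₂ hA₁ hA₂`) and the output field `ψ`,
E(glue G₁ G₂ a b, {□(v)}, Πφ, ΠA, ψ) = Σ_{p,q} Knew(p,q) · E(G₁, {□(v)}, Πφ₁[a ↦ δ_p], ΠA₁, ψ) · E(G₂, {□(v)}, Πφ₂[b ↦ δ_q], ΠA₂, ψ):
cutting the line a—b puts the BASIS FIELD `basisE p = δ_x ⊗ e_a` (p. 414's coordinates) in leg `a` and `basisE q` in leg `b` and
contracts with the line's propagator entry `Knew(p,q)`. [cite: Balaban1983Higgs3, (1.21) p.416] [cite: Balaban1983Higgs3, p.414]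
[cite: Balaban1983Higgs3, p.419] -/
theorem graphAmp_glue_prod (M : Model P N k) (dm2₁ : Fin G₁.nV → HiggsLattice.Site P 0 → ℝ)
    (dm2₂ : Fin G₂.nV → HiggsLattice.Site P 0 → ℝ) (loc₁ : Fin G₁.nV → Loc P k) (loc₂ : Fin G₂.nV → Loc P k)
    (Po₁ : OutPairing G₁) (Po₂ : OutPairing G₂)
    (Ks₁ : SLine G₁ → HiggsLattice.Site P 0 × Fin N → HiggsLattice.Site P 0 × Fin N → ℝ)
    (Ks₂ : SLine G₂ → HiggsLattice.Site P 0 × Fin N → HiggsLattice.Site P 0 × Fin N → ℝ)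
    (Knew : HiggsLattice.Site P 0 × Fin N → HiggsLattice.Site P 0 × Fin N → ℝ)
    (Kv₁ : VLine G₁ → HiggsLattice.PBond P 0 → HiggsLattice.PBond P 0 → ℝ)
    (Kv₂ : VLine G₂ → HiggsLattice.PBond P 0 → HiggsLattice.PBond P 0 → ℝ)
    (Ko₁ : Po₁.Line oRank → HiggsLattice.Site P k × Fin N → HiggsLattice.Site P k × Fin N → ℝ)
    (Ko₂ : Po₂.Line oRank → HiggsLattice.Site P k × Fin N → HiggsLattice.Site P k × Fin N → ℝ)
    (φ : ExtSLeg GG → HiggsLattice.ScalarField P 0 N) (φ₁ : ExtSLeg G₁ → HiggsLattice.ScalarField P 0 N)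
    (φ₂ : ExtSLeg G₂ → HiggsLattice.ScalarField P 0 N)
    (hφ₁ : ∀ x : {x : ExtSLeg G₁ // x.1 ≠ sleg a hsa}, φ (extL (ha := ha) (hb := hb) (hab := hab) hsa hsb x) = φ₁ x.1)
    (hφ₂ : ∀ y : {y : ExtSLeg G₂ // y.1 ≠ sleg b hsb}, φ (extR (ha := ha) (hb := hb) (hab := hab) hsa hsb y) = φ₂ y.1)
    (A : ExtVLeg GG → HiggsLattice.VecField P 0) (A₁ : ExtVLeg G₁ → HiggsLattice.VecField P 0)
    (A₂ : ExtVLeg G₂ → HiggsLattice.VecField P 0)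
    (hA₁ : ∀ x, A (extVL (ha := ha) (hb := hb) (hab := hab) hsa hsb x) = A₁ x)
    (hA₂ : ∀ y, A (extVR (ha := ha) (hb := hb) (hab := hab) hsa hsb y) = A₂ y)
    (κ : ℝ) (ψ : HiggsLattice.ScalarField P k N) :
    graphAmp GG M (Fin.append dm2₁ dm2₂) (Fin.append loc₁ loc₂) (gluePo Po₁ Po₂) (glueKs Ks₁ Ks₂ Knew) (glueKv Kv₁ Kv₂)
        (glueKo Po₁ Po₂ Ko₁ Ko₂) (extS GG φ) (prodExtV A) (extO GG (gluePo Po₁ Po₂) κ ψ) =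
      ∑ p : HiggsLattice.Site P 0 × Fin N, ∑ q : HiggsLattice.Site P 0 × Fin N, Knew p q *
        (graphAmp G₁ M dm2₁ loc₁ Po₁ Ks₁ Kv₁ Ko₁
            (extS G₁ (Function.update φ₁ ⟨sleg a hsa, spartner_sleg ha hsa⟩ (basisE p))) (prodExtV A₁) (extO G₁ Po₁ κ ψ) *
          graphAmp G₂ M dm2₂ loc₂ Po₂ Ks₂ Kv₂ Ko₂
            (extS G₂ (Function.update φ₂ ⟨sleg b hsb, spartner_sleg hb hsb⟩ (basisE q))) (prodExtV A₂) (extO G₂ Po₂ κ ψ)) := by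
  rw [graphAmp_glue hsa hsb M dm2₁ dm2₂ loc₁ loc₂ Po₁ Po₂ Ks₁ Ks₂ Knew Kv₁ Kv₂ Ko₁ Ko₂ _ _ _
    (fun δ => ∏ x : {x : ExtSLeg G₁ // x.1 ≠ sleg a hsa}, φ₁ x.1 (δ x).1 (δ x).2)
    (fun δ => ∏ y : {y : ExtSLeg G₂ // y.1 ≠ sleg b hsb}, φ₂ y.1 (δ y).1 (δ y).2) (prodExtV A₁) (prodExtV A₂)
    (extO G₁ Po₁ κ ψ) (extO G₂ Po₂ κ ψ)]
  · refine Finset.sum_congr rfl fun p _ => Finset.sum_congr rfl fun q _ => ?_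
    simp only [indicator_mul_prod_eq_extS]
  · intro γ
    rw [extS_glue hsa hsb]
    simp only [hφ₁, hφ₂]
  · intro ζ
    rw [prodExtV_glue hsa hsb]
    simp only [hA₁, hA₂]
  · intro ξ
    exact extO_glue Po₁ Po₂ κ ψ ξ

end Cutting

end

end Literature.MathematicalPhysics.QuantumFieldTheory.Balaban1983to89.B3GraphGlueAmplitudeRules
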